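import Summits.AtomisticToContinuum.Crystallization.Theorems.FreeSplittingCertificatesStrictSplittingRuleFarPairBound

/-!
# `StrictSplittingRule` (stmt-AtomisticToContinuum-12560): radial/tangential split of the far pair term

Route `FreeSplittingCertificates`, crux r3 `StrictSplittingRule`, line `registered` (unit b2b-freesplit-B, gen 8).  Companion of
`…FarPairBound.lean` (`stub_farPairLowerBound`: the half-split pair second variation is `≥ −(7/4)s⁻⁵⟪d,v⟫²`).  The far lemma of the
H12⋆ architecture (HOME CERT.md §16 (3)) uses the pair term with BOTH its pieces: writing `x = s⁻¹ = ‖d‖⁻²`, `w = ‖v‖²`, `t = ⟪d,v⟫²`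
(so `w − x t = ‖v‖² − ⟪d̂,v⟫²` is the tangential part),
`½(W′(s)‖v‖² + 2W″(s)⟪d,v⟫²) = ¼x⁴(1 − x³)(w − x t) − (7/4)x⁵ t + (13/4)x⁸ t` EXACTLY (`farPair_split`): a radial DEFICIT `(7/4)‖d‖⁻⁸⟪d̂,v⟫²`
and a tangential CREDIT `¼‖d‖⁻⁸(1 − ‖d‖⁻⁶)(‖v‖² − ⟪d̂,v⟫²)`, up to the positive `(13/4)‖d‖⁻¹⁴⟪d̂,v⟫²`.  These are the coefficients `2⟪x̂,v⟫² − ¼‖v‖²`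
(net radial `7/4`, tangential `−¼`) of the bare part of the far pencil (`farPencilS_le`, `…FarSymbol.lean` §4).
Structural bookkeeping ([folklore]); VALUE = a kernel-checked brick — NOT summit progress.
-/

noncomputable section

namespace Summit.AtomisticToContinuum.Crystallization.Theorems.StrictSplittingRuleBirth

open scoped BigOperators
open Literature.MathematicalPhysics.StatisticalMechanics
open Summit.AtomisticToContinuum.Crystallization.Theorems.PalmUnimodularRigidity.LayeredLawsSelectHcp (hcpSite ljSqDeriv)

/-- **Exact radial/tangential split of the half-split pair second variation** (`x = ‖d‖⁻²`):
`½(W′‖v‖² + 2W″⟪d,v⟫²) = ¼x⁴(1−x³)(‖v‖² − x⟪d,v⟫²) − (7/4)x⁵⟪d,v⟫² + (13/4)x⁸⟪d,v⟫²`. [folklore] -/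
theorem farPair_split (d v : EuclideanSpace ℝ (Fin 3)) :
    1 / 2 * (ljSqDeriv (‖d‖ ^ 2) * ‖v‖ ^ 2 +
        2 * (1 / 2 * (7 * ((‖d‖ ^ 2)⁻¹) ^ 8 - 4 * ((‖d‖ ^ 2)⁻¹) ^ 5)) * (inner ℝ d v) ^ 2) =
      1 / 4 * ((‖d‖ ^ 2)⁻¹) ^ 4 * (1 - ((‖d‖ ^ 2)⁻¹) ^ 3) * (‖v‖ ^ 2 - (‖d‖ ^ 2)⁻¹ * (inner ℝ d v) ^ 2) -
        7 / 4 * ((‖d‖ ^ 2)⁻¹) ^ 5 * (inner ℝ d v) ^ 2 + 13 / 4 * ((‖d‖ ^ 2)⁻¹) ^ 8 * (inner ℝ d v) ^ 2 := by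
  simp only [ljSqDeriv]
  ring

/-- **Far pair term with the tangential credit kept**: for `‖d‖² ≥ 1`,
`½(W′‖v‖² + 2W″⟪d,v⟫²) ≥ ¼x⁴(1−x³)(‖v‖² − x⟪d,v⟫²) − (7/4)x⁵⟪d,v⟫²` with `x = ‖d‖⁻²` and `‖v‖² − x⟪d,v⟫² ≥ 0` (Cauchy–Schwarz):
radial deficit `7/4`, tangential credit `¼(1 − ‖d‖⁻⁶)` per `‖d‖⁻⁸`. [folklore] -/
theorem farPair_lower_bound_tan (d v : EuclideanSpace ℝ (Fin 3)) (hd : 1 ≤ ‖d‖ ^ 2) :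
    1 / 4 * ((‖d‖ ^ 2)⁻¹) ^ 4 * (1 - ((‖d‖ ^ 2)⁻¹) ^ 3) * (‖v‖ ^ 2 - (‖d‖ ^ 2)⁻¹ * (inner ℝ d v) ^ 2) -
        7 / 4 * ((‖d‖ ^ 2)⁻¹) ^ 5 * (inner ℝ d v) ^ 2 ≤
      1 / 2 * (ljSqDeriv (‖d‖ ^ 2) * ‖v‖ ^ 2 +
        2 * (1 / 2 * (7 * ((‖d‖ ^ 2)⁻¹) ^ 8 - 4 * ((‖d‖ ^ 2)⁻¹) ^ 5)) * (inner ℝ d v) ^ 2) ∧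
    0 ≤ ‖v‖ ^ 2 - (‖d‖ ^ 2)⁻¹ * (inner ℝ d v) ^ 2 := by
  have hs0 : 0 < ‖d‖ ^ 2 := one_pos.trans_le hd
  have hx0 : 0 ≤ (‖d‖ ^ 2)⁻¹ := (inv_pos.2 hs0).le
  have hcs : (inner ℝ d v) ^ 2 ≤ ‖d‖ ^ 2 * ‖v‖ ^ 2 := by
    rw [← mul_pow, ← sq_abs (inner ℝ d v)]
    exact pow_le_pow_left₀ (abs_nonneg _) (abs_real_inner_le_norm d v) 2
  have htan : 0 ≤ ‖v‖ ^ 2 - (‖d‖ ^ 2)⁻¹ * (inner ℝ d v) ^ 2 := by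
    rw [sub_nonneg]
    calc (‖d‖ ^ 2)⁻¹ * (inner ℝ d v) ^ 2 ≤ (‖d‖ ^ 2)⁻¹ * (‖d‖ ^ 2 * ‖v‖ ^ 2) := mul_le_mul_of_nonneg_left hcs hx0
      _ = ‖v‖ ^ 2 := by rw [← mul_assoc, inv_mul_cancel₀ hs0.ne', one_mul]
  refine ⟨?_, htan⟩
  rw [farPair_split]
  have : 0 ≤ 13 / 4 * ((‖d‖ ^ 2)⁻¹) ^ 8 * (inner ℝ d v) ^ 2 := by positivity
  linarith

end Summit.AtomisticToContinuum.Crystallization.Theorems.StrictSplittingRuleBirth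

end
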